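import Literature.Topology.FourManifolds.ModelBridge
import Literature.Topology.FourManifolds.ChordHostZero
import Literature.Topology.FourManifolds.SegFrame
import HarnessLib

/-!
# The third segment conjugation: the host of a flip frame onto the chord host

Topic `Literature/Topology/FourManifolds` (trunk T-4MAN). Fact seat
`provefact-Literature.Topology.FourManifolds.Knot.IsConnectedSum.isIsotopic` (Schubert's theorem),
geometric heart for rail knots. Data: two flip pairs `(b, c)` and `(b₁, b₂)` at flat scales
(`FlatHost.FlatHyp`, at all smaller scales too). The **third segment conjugation** frames the bent
knots of the flip frame of `b` at `u = 0` (wall reference `Hb.wallRef 0`, `WallHost.lean`) for the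
segment data `segData₃`: the ambient isotopy carries the host `Hb.host 0` onto the chord host
`chordH₃ = chordHostZ` of `ChordHostZero.lean` (the model bridge `ModelBridge.lean` followed by the
lift reparametrisation), the straight host segment `o + [-1, 1/2] d` onto the chord
`o' + [-1, 1/2] d'` of `b₂`, clock for clock. With the far radius of the chord host
(`exists_far_radius₃`) the generic frame of `SegFrame.lean` applies: the bent knot of the flip
frame — isotopic to `B` (`isIsotopic_bent_B`, the unit lemma at `u = 0`) — is isotopic to the
output knot `outOne` (`isIsotopic_outThree_B`).

Everything is proved; no named facts are introduced.

## References

* M. W. Hirsch, *Differential Topology*, GTM 33 (1976), Ch. 8 §1, Thm. 1.3. [HirschDT1976]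
-/

open scoped Manifold ContDiff Topology Real
open Function Set Metric Filter

noncomputable section

namespace Literature.Topology.FourManifolds

/-- Local notation: `𝔼 n` is the model Euclidean space `EuclideanSpace ℝ (Fin n)`. -/
local notation "𝔼 " n:arg => EuclideanSpace ℝ (Fin n)

/-- Local notation: `𝕊 n` is the unit sphere in `EuclideanSpace ℝ (Fin (n + 1))`. -/
local notation "𝕊 " n:arg => (Metric.sphere (0 : EuclideanSpace ℝ (Fin (n + 1))) 1)

attribute [local instance] fact_finrank_euclideanSpace_succ

open KnotsInBall ExitBend SegmentConj ModelTemplate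

namespace BandData

/-! ### Clock values on the straight parameters -/

/-- **Every clock in `[-1, 1/2]` is attained on the straight host parameters `[strLo, winHi]`.**
[folklore] -/
theorem exists_clockFn_eq' {A B K : Knot} (b : BandData A B K ∅)
    {hcross : b.band ⁻¹' sphereEquator 2 ∩ squareNhd b.δ = {x ∈ squareNhd b.δ | x 0 = 2⁻¹}}
    {ε r A' κ lam₀ : ℝ} (HU : b.ShrinkScaleU hcross ε r A' κ) (hl : lam₀ ∈ Ioc (0 : ℝ) 1) (hl2 : lam₀ ≤ 1 / 2)
    {ρ : ℝ} (hρ : ρ ∈ Icc (-1 : ℝ) (1 / 2)) :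
    ∃ u ∈ Icc (b.strLo HU) (b.winHi HU hl), b.clockFn HU hl hl2 u = ρ := by
  obtain ⟨m1, m2, m3, m3', m4, m5⟩ := b.str_marks HU hl
  obtain ⟨v1, -⟩ := b.clockFn_strLo_strHi HU hl hl2
  have v2 := b.clockFn_winHi HU hl hl2
  have hww : b.winLo HU hl < b.winHi HU hl := by
    linarith [b.winLo_lt_collarLo HU hl hl2, b.collarLo_lt_collarHi HU hl hl2, b.collarHi_lt_winHi HU hl hl2]
  have hcont := (b.contDiff_clockFn HU hl hl2).continuous.continuousOn (s := Icc (b.strLo HU) (b.winHi HU hl))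
  have hy : ρ ∈ Icc (b.clockFn HU hl hl2 (b.strLo HU)) (b.clockFn HU hl hl2 (b.winHi HU hl)) := by rw [v1, v2]; exact hρ
  exact intermediate_value_Icc (by linarith) hcont hy

section Three

variable {A B K : Knot} {b : BandData A B K ∅} {Ac Bc Kc : Knot} {c : BandData Ac Bc Kc ∅}
  {hcross : b.band ⁻¹' sphereEquator 2 ∩ squareNhd b.δ = {x ∈ squareNhd b.δ | x 0 = 2⁻¹}}
  {hcrossc : c.band ⁻¹' sphereEquator 2 ∩ squareNhd c.δ = {x ∈ squareNhd c.δ | x 0 = 2⁻¹}}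
  {ε r A' εc rc ε' r' κ : ℝ} (Hb : FlatHyp hcross hcrossc ε r A' εc rc ε' r' κ)
  {A₁ B₁ K₁ : Knot} {b₁ : BandData A₁ B₁ K₁ ∅} {A₂ B₂ K₂ : Knot} {b₂ : BandData A₂ B₂ K₂ ∅}
  {hcross₁ : b₁.band ⁻¹' sphereEquator 2 ∩ squareNhd b₁.δ = {x ∈ squareNhd b₁.δ | x 0 = 2⁻¹}}
  {hcross₂ : b₂.band ⁻¹' sphereEquator 2 ∩ squareNhd b₂.δ = {x ∈ squareNhd b₂.δ | x 0 = 2⁻¹}}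
  {ε₁ r₁ A₁' ε₂ r₂ ε₁' r₁' κ₁ : ℝ} (H₁ : FlatHyp hcross₁ hcross₂ ε₁ r₁ A₁' ε₂ r₂ ε₁' r₁' κ₁)
  (Hball : ∀ κ', 0 < κ' → κ' ≤ κ → FlatHyp hcross hcrossc ε r A' εc rc ε' r' κ')
  (H₁all : ∀ κ', 0 < κ' → κ' ≤ κ₁ → FlatHyp hcross₁ hcross₂ ε₁ r₁ A₁' ε₂ r₂ ε₁' r₁' κ')
  (hsmall : ∀ s, ‖κ₁ • b₁.frame hcross₁ (template b₁.depthSign s)‖ ≤ 1 / 2)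

namespace FlatHyp

/-- **The chord host of the third conjugation**: `R ∘ H₁.host 1` over the circle of `b`, with the
clock of the reference scale. [folklore] -/
def chordH₃ : Knot := b.chordHostZ Hb.HU WallRef.half_mem (by norm_num) H₁

include Hball H₁all hsmall in
/-- **THE HOST OF THE FLIP FRAME AT `u = 0` IS ISOTOPIC TO THE CHORD HOST** (model bridge, then the
lift reparametrisation). [cite: HirschDT1976, Ch. 8 §1, Thm. 1.3] -/
theorem isIsotopic_host_chordH₃ : (Hb.host zero_mem01).IsIsotopic (chordH₃ Hb H₁) :=
  IsAmbientIsotopic.trans_holds (Hb.isIsotopic_host_zero_map_host_one H₁ Hball H₁all hsmall)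
    (IsAmbientIsotopic.symm_holds (b.isIsotopic_chordHostZ_hostR Hb.HU WallRef.half_mem (by norm_num) H₁))

include Hball H₁all hsmall in
/-- Existence of the ambient isotopy of the third conjugation. [folklore] -/
theorem exists_Psi₃ : ∃ Ψ : AmbientIsotopy (𝓡 3) (𝕊 3), Ψ.toFun 1 ∘ ⇑(Hb.host zero_mem01) = ⇑(chordH₃ Hb H₁) :=
  isIsotopic_host_chordH₃ Hb H₁ Hball H₁all hsmall

/-- **The ambient isotopy** `Ψ₃` with `Ψ₃,₁ ∘ host = chordH₃`. [folklore] -/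
def Psi₃ : AmbientIsotopy (𝓡 3) (𝕊 3) := (exists_Psi₃ Hb H₁ Hball H₁all hsmall).choose

/-- `Ψ₃,₁ ∘ host = chordH₃`. [folklore] -/
theorem Psi₃_host (x : 𝕊 1) : stageOne (Psi₃ Hb H₁ Hball H₁all hsmall) (Hb.host zero_mem01 x) = chordH₃ Hb H₁ x := by
  have := congrFun (exists_Psi₃ Hb H₁ Hball H₁all hsmall).choose_spec x
  rw [comp_apply] at this
  rw [← this, stageOne, AmbientIsotopy.coe_toDiffeomorph]
  rfl

/-- The same, for the reference host of the wall reference. [folklore] -/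
theorem Psi₃_wallRef_host (x : 𝕊 1) :
    stageOne (Psi₃ Hb H₁ Hball H₁all hsmall) ((Hb.wallRef zero_mem01).host x) = chordH₃ Hb H₁ x :=
  Psi₃_host Hb H₁ Hball H₁all hsmall x

/-- **THE SEGMENT DATA OF THE THIRD CONJUGATION.** [folklore] -/
def segData₃ : SegData where
  Ψ := Psi₃ Hb H₁ Hball H₁all hsmall
  o := (Hb.wallRef zero_mem01).segO
  o' := chordO H₁.arc
  d := (Hb.wallRef zero_mem01).segD
  d' := chordD H₁.arc
  ρlo := -1
  ρhi := 1 / 2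
  d_ne := (Hb.wallRef zero_mem01).segD_ne_zero
  ρlo_neg := by norm_num
  ρhi_pos := by norm_num
  seg ρ hρ := by
    obtain ⟨u, hu, huρ⟩ := b.exists_clockFn_eq' Hb.HU WallRef.half_mem (by norm_num) hρ
    obtain ⟨m1, m2, m3, m3', m4, m5⟩ := b.str_marks Hb.HU WallRef.half_mem
    have e := (Hb.wallRef zero_mem01).host_straight hu
    rw [← huρ, ← e, Psi₃_wallRef_host, chordH₃, b.chordHostZ_circlePt_of_mem Hb.HU WallRef.half_mem _ H₁ ⟨hu.1, by linarith [hu.2]⟩]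

/-- The fields of the segment data. [folklore] -/
theorem segData₃_o : (segData₃ Hb H₁ Hball H₁all hsmall).o = (Hb.wallRef zero_mem01).segO := rfl
/-- The fields of the segment data. [folklore] -/
theorem segData₃_d : (segData₃ Hb H₁ Hball H₁all hsmall).d = (Hb.wallRef zero_mem01).segD := rfl
/-- The fields of the segment data. [folklore] -/
theorem segData₃_o' : (segData₃ Hb H₁ Hball H₁all hsmall).o' = chordO H₁.arc := rfl
/-- The fields of the segment data. [folklore] -/
theorem segData₃_d' : (segData₃ Hb H₁ Hball H₁all hsmall).d' = chordD H₁.arc := rfl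
/-- The fields of the segment data. [folklore] -/
theorem segData₃_ρlo : (segData₃ Hb H₁ Hball H₁all hsmall).ρlo = -1 := rfl
/-- The fields of the segment data. [folklore] -/
theorem segData₃_ρhi : (segData₃ Hb H₁ Hball H₁all hsmall).ρhi = 1 / 2 := rfl
/-- The fields of the segment data. [folklore] -/
theorem segData₃_Ψ : (segData₃ Hb H₁ Hball H₁all hsmall).Ψ = Psi₃ Hb H₁ Hball H₁all hsmall := rfl

/-! ### The far radius of the chord host -/

/-- **THE FAR RADIUS**: chord host points of parameters off the open straight range `(strLo, winHi)`
are the north pole or at chart distance `≥ R₁ > 0` from the chord centre `o'`. [folklore] -/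
theorem exists_far_radius₃ : ∃ R₁ > 0, ∀ t ∈ Icc b.alo (b.alo + 1), t ∉ Ioo (b.strLo Hb.HU) (b.winHi Hb.HU WallRef.half_mem) →
    chordH₃ Hb H₁ (circlePt t) = northPole ∨ R₁ ≤ ‖psiN (chordH₃ Hb H₁ (circlePt t)) - chordO H₁.arc‖ := by
  set H := chordH₃ Hb H₁ with hH
  have hl2 : (1 / 2 : ℝ) ≤ 1 / 2 := le_rfl
  obtain ⟨m1, m2, m3, m3', m4, m5⟩ := b.str_marks Hb.HU WallRef.half_mem
  have hcm := b.core_marks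
  have hwc := b.winHi_mem_core Hb.HU WallRef.half_mem
  have hlc := b.parLo_mem_core Hb.κ_pos Hb.h7 quarter_mem7
  have hε := b.epsLo_bounds.1
  obtain ⟨t₀, ht₀, ht₀v⟩ := b.exists_clockFn_eq' Hb.HU WallRef.half_mem hl2 (ρ := 0) ⟨by norm_num, by norm_num⟩
  obtain ⟨v1, -⟩ := b.clockFn_strLo_strHi Hb.HU WallRef.half_mem hl2
  have v2 := b.clockFn_winHi Hb.HU WallRef.half_mem hl2
  have ht₀1 : b.strLo Hb.HU < t₀ := lt_of_le_of_ne ht₀.1 fun h ↦ by rw [← h, v1] at ht₀v; norm_num at ht₀v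
  have ht₀2 : t₀ < b.winHi Hb.HU WallRef.half_mem := lt_of_le_of_ne ht₀.2 fun h ↦ by rw [h, v2] at ht₀v; norm_num at ht₀v
  have hx₀ : H (circlePt t₀) = psiN.symm (chordO H₁.arc) := by
    rw [hH, chordH₃, b.chordHostZ_circlePt_of_mem Hb.HU WallRef.half_mem _ H₁ ⟨ht₀.1, by linarith [ht₀.2]⟩, ht₀v, zero_smul, add_zero]
  have halo : b.alo < b.strLo Hb.HU := by
    have : b.strLo Hb.HU = b.parLo Hb.κ_pos Hb.h7 quarter_mem7 := rfl
    linarith [hlc.1]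
  have halo' : b.winHi Hb.HU WallRef.half_mem < b.alo + 1 := by linarith [hwc.2]
  set T : Set ℝ := Icc b.alo (b.alo + 1) \ Ioo (b.strLo Hb.HU) (b.winHi Hb.HU WallRef.half_mem) with hT'
  have hTc : IsCompact T := isCompact_Icc.diff isOpen_Ioo
  have hTne : T.Nonempty := ⟨b.alo, ⟨left_mem_Icc.2 (by linarith), fun h ↦ by linarith [h.1]⟩⟩
  set f : ℝ → 𝔼 4 := fun t ↦ ((H (circlePt t) : 𝕊 3) : 𝔼 4) with hf'
  have hfc : Continuous f := by
    have : f = Knot.curve H := funext fun t ↦ (Knot.curve_apply (K := H) t).symm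
    rw [this]; exact H.continuous_curve
  set g : ℝ → ℝ := fun t ↦ ‖f t - f t₀‖ with hg'
  have hgc : Continuous g := (hfc.sub continuous_const).norm
  have hpos : ∀ t ∈ T, 0 < g t := by
    intro t ht
    simp only [hg', norm_pos_iff, sub_ne_zero, hf']
    intro he
    have he' : Knot.curve H t = Knot.curve H t₀ := by rw [Knot.curve_apply, Knot.curve_apply]; exact he
    obtain ⟨m, hm⟩ := H.curve_eq_curve_iff.1 he'
    have h1 : (m : ℝ) < 1 := by linarith [ht.1.2]
    have h2 : (-1 : ℝ) < m := by linarith [ht.1.1]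
    have h1' : m < 1 := by exact_mod_cast h1
    have h2' : -1 < m := by exact_mod_cast h2
    have hm0 : m = 0 := by omega
    rw [hm0, Int.cast_zero, add_zero] at hm
    exact ht.2 ⟨by rw [hm]; exact ht₀1, by rw [hm]; exact ht₀2⟩
  obtain ⟨tm, htm, hmin⟩ := hTc.exists_isMinOn hTne hgc.continuousOn
  set m := g tm with hm'
  have hm0 : 0 < m := hpos tm htm
  have hcs : Continuous fun y : 𝔼 3 ↦ ((psiN.symm y : 𝕊 3) : 𝔼 4) := contDiff_coe_psiN_symm.continuous
  obtain ⟨R₁, hR₁, hR⟩ := Metric.continuousAt_iff.1 (hcs.continuousAt (x := chordO H₁.arc)) m hm0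
  refine ⟨R₁, hR₁, fun t ht hts ↦ ?_⟩
  by_cases hN : H (circlePt t) = northPole
  · exact Or.inl hN
  · right
    by_contra hlt
    push Not at hlt
    have h1 := hR (by rw [dist_eq_norm]; exact hlt)
    rw [psiN_symm_apply_psiN hN, dist_eq_norm] at h1
    have h2 : m ≤ g t := hmin ⟨ht, hts⟩
    have e : ((psiN.symm (chordO H₁.arc) : 𝕊 3) : 𝔼 4) = f t₀ := by simp only [hf']; rw [hx₀]
    rw [e] at h1
    exact absurd h2 (not_le.2 h1)

/-! ### The bent knot of the flip frame is the second summand -/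

/-- **THE BENT KNOT OF THE FLIP FRAME AT `u = 0` IS ISOTOPIC TO `B`** (unit lemma at `u = 0`:
bent knot `≃` frame knot `= flipKnot 0 ≃ B`). [cite: HirschDT1976, Ch. 8 §1, Thm. 1.3] -/
theorem isIsotopic_bent_B (hBA : B = Ac.map (reflectLastDiffeo 3)) {lam₀ rA : ℝ} (hl₀ : lam₀ ∈ Ioc (0 : ℝ) 1) (hrA : 0 < rA) :
    ((Hb.wallRef zero_mem01).bent hl₀ hrA).IsIsotopic B := by
  have hb := b.isIsotopic_frameKnot_bentKnot Hb.HU (Hb.isWallFrame zero_mem01) hl₀ hrA Hb.hB Hb.hAB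
  exact IsAmbientIsotopic.trans_holds (IsAmbientIsotopic.symm_holds hb)
    (isIsotopic_flipKnot_zero_B Hb.HU Hb.arc Hb.pair hBA Hb.pairScale Hb.flat Hb.eps_le Hb.five_lt Hb.hA Hb.hB Hb.hAB Hb.hB₂)

/-! ### The output of the third conjugation -/

variable {ρ₂ R₀ lam₀ rA : ℝ} (U : (Hb.wallRef zero_mem01).UnitScale ρ₂ R₀ lam₀ rA) (hρ4 : ρ₂ ≤ 1 / 4) {R₁ rc : ℝ}
  (hfar : ∀ t ∈ Icc b.alo (b.alo + 1), t ∉ Ioo (b.strLo Hb.HU) (b.winHi Hb.HU WallRef.half_mem) →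
    chordH₃ Hb H₁ (circlePt t) = northPole ∨ R₁ ≤ ‖psiN (chordH₃ Hb H₁ (circlePt t)) - chordO H₁.arc‖)
  (hS : (segData₃ Hb H₁ Hball H₁all hsmall).Small (-ρ₂) ρ₂ R₀ R₁ rc)

/-- **THE OUTPUT KNOT OF THE THIRD CONJUGATION.** [folklore] -/
def outThree : Knot :=
  U.outOne (segData₃ Hb H₁ Hball H₁all hsmall) rfl rfl rfl rfl (Psi₃_wallRef_host Hb H₁ Hball H₁all hsmall) hρ4 hfar hS

/-- **THE OUTPUT KNOT OF THE THIRD CONJUGATION IS ISOTOPIC TO `B`.** [cite: HirschDT1976, Ch. 8 §1, Thm. 1.3] -/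
theorem isIsotopic_outThree_B (hBA : B = Ac.map (reflectLastDiffeo 3)) : (outThree Hb H₁ Hball H₁all hsmall U hρ4 hfar hS).IsIsotopic B :=
  IsAmbientIsotopic.trans_holds (IsAmbientIsotopic.symm_holds
    (U.isIsotopic_bent_outOne (segData₃ Hb H₁ Hball H₁all hsmall) rfl rfl rfl rfl (Psi₃_wallRef_host Hb H₁ Hball H₁all hsmall) hρ4 hfar hS))
    (isIsotopic_bent_B Hb hBA U.hl₀ U.hrA)

/-- **The output knot off the window**: `Ψ₃,₁` of the bent knot. [folklore] -/
theorem outThree_circlePt_of_not_mem {t : ℝ} (ht : t ∈ Ico b.alo (b.alo + 1)) (hts : t ∉ Icc (U.w₁ hρ4) (U.w₂ hρ4)) :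
    outThree Hb H₁ Hball H₁all hsmall U hρ4 hfar hS (circlePt t) =
      stageOne (Psi₃ Hb H₁ Hball H₁all hsmall) ((Hb.wallRef zero_mem01).bent U.hl₀ U.hrA (circlePt t)) :=
  U.outOne_circlePt_of_not_mem (segData₃ Hb H₁ Hball H₁all hsmall) rfl rfl rfl rfl (Psi₃_wallRef_host Hb H₁ Hball H₁all hsmall) hρ4 hfar hS ht hts

/-- **The output knot on the window**: `ψ⁻¹ (A (ψ (bent knot)))`. [folklore] -/
theorem coe_outThree_circlePt_of_mem {s : ℝ} (hs : s ∈ Icc (U.w₁ hρ4) (U.w₂ hρ4)) :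
    ((outThree Hb H₁ Hball H₁all hsmall U hρ4 hfar hS (circlePt s) : 𝕊 3) : 𝔼 4) =
      ((psiN.symm ((segData₃ Hb H₁ Hball H₁all hsmall).A (psiN ((Hb.wallRef zero_mem01).bent U.hl₀ U.hrA (circlePt s)))) : 𝕊 3) : 𝔼 4) :=
  U.coe_outOne_circlePt_of_mem (segData₃ Hb H₁ Hball H₁all hsmall) rfl rfl rfl rfl (Psi₃_wallRef_host Hb H₁ Hball H₁all hsmall) hρ4 hfar hS hs

include Hball H₁all hsmall in
/-- **EXISTENCE OF THE THRESHOLDS OF THE THIRD CONJUGATION.** [folklore] -/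
theorem exists_thresholds₃ :
    ∃ R₁ > 0, (∀ t ∈ Icc b.alo (b.alo + 1), t ∉ Ioo (b.strLo Hb.HU) (b.winHi Hb.HU WallRef.half_mem) →
      chordH₃ Hb H₁ (circlePt t) = northPole ∨ R₁ ≤ ‖psiN (chordH₃ Hb H₁ (circlePt t)) - chordO H₁.arc‖) ∧
      ∃ ρmax > 0, ∀ ρ₂', 0 < ρ₂' → ρ₂' ≤ ρmax → ∃ R₀' > 0, ∃ rc, ∀ R₀'', 0 < R₀'' → R₀'' ≤ R₀' →
        (segData₃ Hb H₁ Hball H₁all hsmall).Small (-ρ₂') ρ₂' R₀'' R₁ rc := by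
  obtain ⟨R₁, hR₁, hfar⟩ := exists_far_radius₃ Hb H₁
  exact ⟨R₁, hR₁, hfar, WallRef.UnitScale.exists_thresholds (segData₃ Hb H₁ Hball H₁all hsmall) hR₁⟩

end FlatHyp

end Three

end BandData

end Literature.Topology.FourManifolds
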